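import Mathlib

/-!
# SoloBlind kernel #209 — discrete Carlson–Levin inequality (elementary constant)

The `L¹` mass of a sequence is controlled by its `ℓ²` norm and its first-moment `ℓ²` norm:
for `1 ≤ T ≤ N`,
`Σ_{n<N} |a n| ≤ √T · √(Σ_{n<N} a n²) + (√T)⁻¹ · √(Σ_{n<N} (n+1)² a n²)`,
obtained by Cauchy–Schwarz on the head `n < T` and on the tail `T ≤ n` (with weights `1/(n+1)`,
whose squares sum to at most `1/T` by telescoping).  Optimising `T` gives the Carlson form
`Σ |a| ≤ 2 (Σ a²)^{1/4} (Σ (n+1)² a²)^{1/4}` up to the integer rounding of `T`.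
This is the `L² → L¹` step of LEMMA R's fast remainder (blueprint A8, R.2): the two quadratic
functionals are Plancherel integrals of pole-removed local resolvent elements, and the measured loss of
this step on the true kernels is 1.2–1.8 (SB-C1099).
-/

namespace Summit.AnomalousDissipation.AnomalousDissipation.Theorems

open Finset

/-- Head estimate: `Σ_{n<T} |a n| ≤ √T · √(Σ_{n<T} a n²)` (Cauchy–Schwarz against the constant
sequence `1`). -/
theorem carlson_head (a : ℕ → ℝ) (T : ℕ) :
    ∑ n ∈ range T, |a n| ≤ Real.sqrt T * Real.sqrt (∑ n ∈ range T, a n ^ 2) := by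
  have hcs := sum_mul_sq_le_sq_mul_sq (range T) (fun _ => (1 : ℝ)) (fun n => |a n|)
  simp only [one_mul, one_pow, sum_const, card_range, nsmul_eq_mul, mul_one, sq_abs] at hcs
  have h := Real.abs_le_sqrt hcs
  rwa [abs_of_nonneg (sum_nonneg fun i _ => abs_nonneg (a i)),
    Real.sqrt_mul (Nat.cast_nonneg T)] at h

/-- Telescoping bound for the tail weights: `Σ_{T ≤ n < N} 1/(n+1)² ≤ 1/T` for `1 ≤ T`. -/
theorem sum_Ico_inv_sq_le (T N : ℕ) (hT : 1 ≤ T) :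
    ∑ n ∈ Ico T N, 1 / ((n : ℝ) + 1) ^ 2 ≤ 1 / (T : ℝ) := by
  by_cases hTN : T ≤ N
  · -- stronger statement by induction from `T`
    suffices h : ∑ n ∈ Ico T N, 1 / ((n : ℝ) + 1) ^ 2 ≤ 1 / (T : ℝ) - 1 / (N : ℝ) by
      have : (0 : ℝ) ≤ 1 / (N : ℝ) := by positivity
      linarith
    induction N, hTN using Nat.le_induction with
    | base => simp
    | succ N hTN ih =>
      rw [sum_Ico_succ_top hTN]
      have hN1 : (1 : ℝ) ≤ (N : ℝ) := by exact_mod_cast le_trans hT hTN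
      have hN0 : (0 : ℝ) < (N : ℝ) := by linarith
      have key : 1 / ((N : ℝ) + 1) ^ 2 ≤ 1 / (N : ℝ) - 1 / ((N : ℝ) + 1) := by
        rw [div_sub_div _ _ hN0.ne' (by linarith), div_le_div_iff₀ (by positivity) (by positivity)]
        nlinarith
      push_cast
      linarith
  · rw [Ico_eq_empty (by omega), sum_empty]
    positivity

/-- Tail estimate: for `1 ≤ T`, `Σ_{T ≤ n < N} |a n| ≤ (√T)⁻¹ · √(Σ_{T ≤ n < N} (n+1)² a n²)`
(Cauchy–Schwarz with weights `1/(n+1)` and the telescoping bound). -/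
theorem carlson_tail (a : ℕ → ℝ) (T N : ℕ) (hT : 1 ≤ T) :
    ∑ n ∈ Ico T N, |a n| ≤
      (Real.sqrt T)⁻¹ * Real.sqrt (∑ n ∈ Ico T N, ((n : ℝ) + 1) ^ 2 * a n ^ 2) := by
  have hcs := sum_mul_sq_le_sq_mul_sq (Ico T N) (fun n => 1 / ((n : ℝ) + 1))
    (fun n => ((n : ℝ) + 1) * |a n|)
  have hre : ∀ n ∈ Ico T N, 1 / ((n : ℝ) + 1) * (((n : ℝ) + 1) * |a n|) = |a n| := by
    intro n _
    have : (n : ℝ) + 1 ≠ 0 := by positivity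
    field_simp
  rw [sum_congr rfl hre] at hcs
  have hw := sum_Ico_inv_sq_le T N hT
  have hX : 0 ≤ ∑ n ∈ Ico T N, (((n : ℝ) + 1) * |a n|) ^ 2 := sum_nonneg fun i _ => sq_nonneg _
  have h2 : (∑ n ∈ Ico T N, |a n|) ^ 2 ≤
      (1 / (T : ℝ)) * ∑ n ∈ Ico T N, ((n : ℝ) + 1) ^ 2 * a n ^ 2 := by
    have e : ∑ n ∈ Ico T N, (((n : ℝ) + 1) * |a n|) ^ 2 =
        ∑ n ∈ Ico T N, ((n : ℝ) + 1) ^ 2 * a n ^ 2 := by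
      refine sum_congr rfl fun n _ => ?_
      rw [mul_pow, sq_abs]
    have e1 : ∑ n ∈ Ico T N, (1 / ((n : ℝ) + 1)) ^ 2 = ∑ n ∈ Ico T N, 1 / ((n : ℝ) + 1) ^ 2 := by
      refine sum_congr rfl fun n _ => ?_
      rw [div_pow, one_pow]
    rw [e1, e] at hcs
    calc (∑ n ∈ Ico T N, |a n|) ^ 2
        ≤ (∑ n ∈ Ico T N, 1 / ((n : ℝ) + 1) ^ 2) * ∑ n ∈ Ico T N, ((n : ℝ) + 1) ^ 2 * a n ^ 2 := hcs
      _ ≤ (1 / (T : ℝ)) * ∑ n ∈ Ico T N, ((n : ℝ) + 1) ^ 2 * a n ^ 2 := by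
          apply mul_le_mul_of_nonneg_right hw
          exact sum_nonneg fun i _ => by positivity
  have h := Real.abs_le_sqrt h2
  have hTpos : (0 : ℝ) ≤ 1 / (T : ℝ) := by positivity
  rw [abs_of_nonneg (sum_nonneg fun i _ => abs_nonneg (a i)), Real.sqrt_mul hTpos,
    one_div, Real.sqrt_inv] at h
  exact h

/-- Discrete Carlson–Levin inequality with a free splitting parameter `1 ≤ T ≤ N`:
`Σ_{n<N} |a n| ≤ √T · √(Σ_{n<N} a n²) + (√T)⁻¹ · √(Σ_{n<N} (n+1)² a n²)`. -/
theorem carlson_sum (a : ℕ → ℝ) (T N : ℕ) (hT : 1 ≤ T) (hTN : T ≤ N) :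
    ∑ n ∈ range N, |a n| ≤
      Real.sqrt T * Real.sqrt (∑ n ∈ range N, a n ^ 2) +
        (Real.sqrt T)⁻¹ * Real.sqrt (∑ n ∈ range N, ((n : ℝ) + 1) ^ 2 * a n ^ 2) := by
  rw [← sum_range_add_sum_Ico _ hTN]
  have h1 := carlson_head a T
  have h2 := carlson_tail a T N hT
  have m1 : Real.sqrt (∑ n ∈ range T, a n ^ 2) ≤ Real.sqrt (∑ n ∈ range N, a n ^ 2) := by
    apply Real.sqrt_le_sqrt
    apply sum_le_sum_of_subset_of_nonneg (range_mono hTN)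
    intro i _ _; positivity
  have m2 : Real.sqrt (∑ n ∈ Ico T N, ((n : ℝ) + 1) ^ 2 * a n ^ 2) ≤
      Real.sqrt (∑ n ∈ range N, ((n : ℝ) + 1) ^ 2 * a n ^ 2) := by
    apply Real.sqrt_le_sqrt
    apply sum_le_sum_of_subset_of_nonneg
    · rw [range_eq_Ico]; exact Ico_subset_Ico_left (Nat.zero_le T)
    · intro i _ _; positivity
  have p1 : 0 ≤ Real.sqrt (T : ℝ) := Real.sqrt_nonneg _
  have p2 : 0 ≤ (Real.sqrt (T : ℝ))⁻¹ := inv_nonneg.mpr p1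
  calc ∑ n ∈ range T, |a n| + ∑ n ∈ Ico T N, |a n|
      ≤ Real.sqrt T * Real.sqrt (∑ n ∈ range T, a n ^ 2) +
          (Real.sqrt T)⁻¹ * Real.sqrt (∑ n ∈ Ico T N, ((n : ℝ) + 1) ^ 2 * a n ^ 2) := add_le_add h1 h2
    _ ≤ Real.sqrt T * Real.sqrt (∑ n ∈ range N, a n ^ 2) +
          (Real.sqrt T)⁻¹ * Real.sqrt (∑ n ∈ range N, ((n : ℝ) + 1) ^ 2 * a n ^ 2) :=
        add_le_add (mul_le_mul_of_nonneg_left m1 p1) (mul_le_mul_of_nonneg_left m2 p2)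

end Summit.AnomalousDissipation.AnomalousDissipation.Theorems
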